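import Literature.Geometry.Kaehler.ComplexTorusSplitOrthogonalJordanLefschetzSharpness
import Literature.Algebra.Lie.LefschetzInvariantFormExistence
import HarnessLib

/-!
# Looijenga–Lunts (2.6)/(3.1): `u = (-1_V, 1_{V^*})` is a simple element of `𝔰𝔬(V ⊕ V^*)` iff `dim V` is even — a symplectic form on `V` yields the `𝔰𝔩₂`-triple `(e_κ, u, f_κ)`

Topic `Literature/Geometry/Kaehler` (namespace `Literature.LinearAlgebra.Alternating`, continued from row A1-213).  Lane
`lit-hodgefound` (Track 2 foundations library), skeleton seat `lit-hodgefound-skel-1` (generation 52), row **A1-217** of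
`run/shared/lean/pub/lit-hodgefound/SKELETON.md`; the converse of row A1-213's `even_finrank_of_isSimpleElement_gradingElement`
("`u` simple ⟹ `dim V` even", a symplectic form being FORCED by an `𝔰𝔩₂`-triple `(e, u, f)`).  Here, for a REAL
finite-dimensional `V ≠ 0`:

* **`isSimpleElement_gradingElement_of_skew`**: a non-degenerate alternating form `ω` on `V` PRODUCES the triple — with
  `C = ω♭ : V ≃ V^*`, the blocks `e : (x, ξ) ↦ (0, Cx)` and `f : (x, ξ) ↦ (C⁻¹ξ, 0)` lie in `𝔰𝔬(V ⊕ V^*)`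
  (skewness of `ω`), `[u, e] = 2e`, `[u, f] = -2f` and `[e, f] = (-1_V, 1_{V^*}) = u`: Looijenga–Lunts' `e_κ = ψ_2(κ)`
  and `f_κ` ("`f_κ` is defined and equal to `Σ_k i_{a_{-k}} i_{a_k}`") of a non-degenerate `2`-form in the model (3.1);
* **`isSimpleElement_gradingElement_of_even`** (an even-dimensional space carries a symplectic form — the tree's
  `exists_bilinForm_skew_separatingLeft`, row A1-1xx `LefschetzInvariantFormExistence`) and
  **`isSimpleElement_gradingElement_iff : IsSimpleElement u ↔ Even (dim V)`** (with row A1-213) — (2.6)'s dichotomy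
  `D_{2m}` (simple `h`) versus `D_{2l+1}`.

THEOREMS ONLY (no definition, no named fact, no `sorry`; net debt `0`); the Lie structure of the ambient `End(V ⊕ V^*)`
is supplied by `letI` inside the proof.  (For a COMPLEX `V = E` the triple is row A1-73's
`ComplexTorusTotalLieAlgebraSimple` §5, through the frame form; the present file is the real, basis-free statement.)
-- TODO(layering): with row A1-213, belongs in `LinearAlgebra/Alternating` once `finrank_so` (row A1-73) moves.

## Source, VERBATIM

E. Looijenga, V. A. Lunts, *A Lie algebra attached to a projective variety*, Invent. Math. **129** (1997) 361–412 (held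
TeX `paper:arxiv-alg-geom_9604014`): §2 (2.6) proof, p. 10 L31–L37: "in case `D_{2l+1}` any end of the Dynkin
diagram […] These addional possibilities disappear if we want `h` to be a simple element (that is, `h = [e,f]` for
certain `e ∈ 𝔤_2` and `f ∈ 𝔤_{-2}`): for the classical cases `A_l` and `D_{2l+1}` this follows from the discussion
following 1.16)"; §1 p. 8 L78–L83: "[a representation of even parity] admits a nondegenerate invariant skew-symmetric
form if and only if all multiplicities are even. In the case of odd parity it is just the other way around."; §3 (3.1)
p. 13 L46–L57 (`u := (-1_V, +1_{V^*})`, `ψ_2 : ∧²V^* → 𝔰𝔬(V ⊕ V^*)_2`, `ψ_{-2} : ∧²V → 𝔰𝔬(V ⊕ V^*)_{-2}`); (3.2)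
p. 13 L86–L101: "Suppose `κ` is a nondegenerate `2`-form on `V` […] it follows that `f_κ` is defined and equal to
`Σ_{k=1}^n i_{a_{-k}} i_{a_k}`."

## Contents (all proved)

* **`isSimpleElement_gradingElement_of_skew`**, **`isSimpleElement_gradingElement_of_even`**,
  **`isSimpleElement_gradingElement_iff`**.

## SCOPE (what is NOT formalised here)

Nothing on Lefschetz PAIRS (row A1-213: for `dim_ℝ V = 2`, `u` is simple but `(𝔰𝔬(2,2), u)` is not a Lefschetz pair;
rows A1-204/A1-211 for the positive cases); nothing geometric.

## References

* [LooijengaLunts1997] E. Looijenga, V. A. Lunts, *A Lie algebra attached to a projective variety*, Invent. Math. 129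
  (1997) 361–412; arXiv:alg-geom/9604014. §1 p. 8; §2 (2.6) p. 10; §3 (3.1), (3.2) p. 13.
-/

namespace Literature.LinearAlgebra.Alternating

open Module Function Literature.Algebra.Lie

variable (V : Type*) [NormedAddCommGroup V] [NormedSpace ℝ V] [FiniteDimensional ℝ V]

/-- **A symplectic form on `V` makes `u` a simple element of `𝔰𝔬(V ⊕ V^*)`**: for `ω` non-degenerate alternating with
`C = ω♭ : V ≃ V^*`, the blocks `e = (x, ξ) ↦ (0, Cx)` and `f = (x, ξ) ↦ (C⁻¹ξ, 0)` lie in `𝔰𝔬(V ⊕ V^*)` and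
`(e, u, f)` is an `𝔰𝔩₂`-triple (`[e, f] = (-1_V, 1_{V^*}) = u`) — Looijenga–Lunts' `e_κ`, `f_κ` of a non-degenerate
`2`-form `κ` in the model (3.1)/(3.2) ("`f_κ` is defined and equal to `Σ i_{a_{-k}} i_{a_k}`").
[cite: LooijengaLunts1997, §3 (3.2) p. 13 L86–L101, (3.1) p. 13 L46–L57; §1 p. 8 L81–L82] -/
theorem isSimpleElement_gradingElement_of_skew [Nontrivial V] {ω : LinearMap.BilinForm ℝ V} (hskew : ∀ x y, ω y x = -ω x y)
    (hsep : ω.SeparatingLeft) : IsSimpleElement (⟨gradingElement V, gradingElement_mem_so V⟩ : so V) := by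
  -- `C = ω♭ : V → V^*` (continuous duals), a linear bijection
  let C : V →ₗ[ℝ] (V →L[ℝ] ℝ) := (LinearMap.toContinuousLinearMap : (V →ₗ[ℝ] ℝ) ≃ₗ[ℝ] (V →L[ℝ] ℝ)).toLinearMap ∘ₗ ω
  have hC : ∀ x y, C x y = ω x y := fun x y ↦ rfl
  have hCinj : Injective C := by
    rw [← LinearMap.ker_eq_bot, LinearMap.ker_eq_bot']
    intro x hx
    exact hsep x fun y ↦ by rw [← hC, hx, zero_apply]
  have hCbij : Bijective C :=
    ⟨hCinj, (LinearMap.injective_iff_surjective_of_finrank_eq_finrank (finrank_dual_eq V).symm).1 hCinj⟩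
  let Ce : V ≃ₗ[ℝ] (V →L[ℝ] ℝ) := LinearEquiv.ofBijective C hCbij
  have hCe : ∀ x, Ce x = C x := fun x ↦ rfl
  let D : (V →L[ℝ] ℝ) →ₗ[ℝ] V := Ce.symm.toLinearMap
  have hCD : ∀ ξ, C (D ξ) = ξ := fun ξ ↦ by rw [← hCe]; exact Ce.apply_symm_apply ξ
  have hDC : ∀ x, D (C x) = x := fun x ↦ by
    show Ce.symm (C x) = x
    rw [← hCe]; exact Ce.symm_apply_apply x
  -- the blocks
  let e : Module.End ℝ (sumDual V) := LinearMap.inr ℝ V (V →L[ℝ] ℝ) ∘ₗ C ∘ₗ LinearMap.fst ℝ V (V →L[ℝ] ℝ)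
  let f : Module.End ℝ (sumDual V) := LinearMap.inl ℝ V (V →L[ℝ] ℝ) ∘ₗ D ∘ₗ LinearMap.snd ℝ V (V →L[ℝ] ℝ)
  have he_apply : ∀ v : sumDual V, e v = (0, C v.1) := fun v ↦ rfl
  have hf_apply : ∀ v : sumDual V, f v = (D v.2, 0) := fun v ↦ rfl
  have he : e ∈ so V := (mem_so_iff V e).2 fun v w ↦ by
    rw [he_apply, he_apply, splitForm_apply, splitForm_apply, hC, hC, map_zero, add_zero, map_zero, zero_add, hskew]
  have hDskew : ∀ ξ θ : V →L[ℝ] ℝ, θ (D ξ) = -(ξ (D θ)) := fun ξ θ ↦ by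
    obtain ⟨x, rfl⟩ := hCbij.2 ξ
    obtain ⟨y, rfl⟩ := hCbij.2 θ
    rw [hDC, hDC, hC, hC, hskew]
  have hf : f ∈ so V := (mem_so_iff V f).2 fun v w ↦ by
    rw [hf_apply, hf_apply, splitForm_apply, splitForm_apply, zero_apply, zero_add, zero_apply, add_zero, hDskew]
  -- the relations, at the level of `End(V ⊕ V^*)`
  have hue : gradingElement V * e - e * gradingElement V = 2 • e := by
    refine LinearMap.ext fun v ↦ ?_
    rw [LinearMap.sub_apply, Module.End.mul_apply, Module.End.mul_apply, LinearMap.smul_apply, he_apply, he_apply,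
      gradingElement_apply, gradingElement_apply]
    ext <;> simp [two_nsmul, sub_eq_add_neg]
  have huf : gradingElement V * f - f * gradingElement V = -(2 • f) := by
    refine LinearMap.ext fun v ↦ ?_
    rw [LinearMap.sub_apply, Module.End.mul_apply, Module.End.mul_apply, LinearMap.neg_apply, LinearMap.smul_apply,
      hf_apply, hf_apply, gradingElement_apply, gradingElement_apply]
    ext <;> simp [two_nsmul, sub_eq_add_neg]
  have hef : e * f - f * e = gradingElement V := by
    refine LinearMap.ext fun v ↦ ?_
    rw [LinearMap.sub_apply, Module.End.mul_apply, Module.End.mul_apply, he_apply, hf_apply, hf_apply, he_apply,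
      gradingElement_apply, hCD, hDC]
    ext <;> simp
  refine ⟨⟨e, he⟩, ⟨f, hf⟩, ?_⟩
  letI : LieRing (Module.End ℝ (sumDual V)) := LieRing.ofAssociativeRing
  exact
    { h_ne_zero := fun h0 ↦ by
        obtain ⟨x, hx⟩ := exists_ne (0 : V)
        have h := LinearMap.congr_fun (congrArg Subtype.val h0) ((x, 0) : sumDual V)
        rw [ZeroMemClass.coe_zero, LinearMap.zero_apply, gradingElement_apply, Prod.mk_eq_zero, neg_eq_zero] at h
        exact hx h.1
      lie_e_f := Subtype.ext (by rw [LieSubalgebra.coe_bracket, Ring.lie_def]; exact hef)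
      lie_h_e_nsmul := Subtype.ext (by rw [LieSubalgebra.coe_bracket, Ring.lie_def, AddSubmonoidClass.coe_nsmul]; exact hue)
      lie_h_f_nsmul := Subtype.ext (by
        rw [LieSubalgebra.coe_bracket, Ring.lie_def, NegMemClass.coe_neg, AddSubmonoidClass.coe_nsmul]; exact huf) }

/-- **For `dim V` even (`V ≠ 0`), `u` is a simple element of `𝔰𝔬(V ⊕ V^*)`** — an even-dimensional space carries a
symplectic form (the tree's `exists_bilinForm_skew_separatingLeft`). [cite: LooijengaLunts1997, §1 p. 8 L81–L82 ("admits a nondegenerate invariant skew-symmetric form if and only if all multiplicities are even"), §2 (2.6) p. 10 L31–L37, §3 (3.2) p. 13 L96–L101] -/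
theorem isSimpleElement_gradingElement_of_even [Nontrivial V] (hV : Even (finrank ℝ V)) :
    IsSimpleElement (⟨gradingElement V, gradingElement_mem_so V⟩ : so V) := by
  obtain ⟨ω, hskew, hsep⟩ := exists_bilinForm_skew_separatingLeft (K := ℝ) (V := V) hV
  exact isSimpleElement_gradingElement_of_skew V hskew hsep

/-- **`u` is a simple element of `𝔰𝔬(V ⊕ V^*)` iff `dim V` is even** (`V ≠ 0` real; "only if" is row A1-213's
`even_finrank_of_isSimpleElement_gradingElement`): the classical types `D_{2m}` (simple `h`) versus `D_{2l+1}` ("any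
end of the Dynkin diagram … These additional possibilities disappear if we want `h` to be a simple element").
[cite: LooijengaLunts1997, §2 (2.6) p. 10 L27, L31–L37; §1 p. 8 L78–L83, L96–L98] -/
theorem isSimpleElement_gradingElement_iff [Nontrivial V] :
    IsSimpleElement (⟨gradingElement V, gradingElement_mem_so V⟩ : so V) ↔ Even (finrank ℝ V) :=
  ⟨even_finrank_of_isSimpleElement_gradingElement V, isSimpleElement_gradingElement_of_even V⟩

end Literature.LinearAlgebra.Alternating
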